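import Summits.QuantumFields.YangMills.Theorems.OneCertifiedCubeCrossoverCertificateFrozenAction
import Summits.QuantumFields.YangMills.Theorems.OneCertifiedCubeCrossoverCertificateFrozenLaplace
import Literature.MathematicalPhysics.QuantumLattice.LatticeGaugeDLRGibbsProofs

/-!
# Frozen coupling: the one-cube TV influence of `SU(2)` Wilson theory is at least `1/2` for `β ≥ β₀(b, n)`

Main theorem of the frozen-coupling analysis of crux `CrossoverCertificate` (stmt-QuantumFields-16125):

`exists_beta0_half_le_influence : ∀ b n, 2 ≤ b → 1 ≤ n → ∃ β₀, ∀ β ≥ β₀, 1/2 ≤ Θ(ρ_fund, β, b, n)`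

for `G = SU(2)` in the fundamental representation, where `Θ = influence` is the route's worst-case total-variation
boundary influence on the central cell (`OneCertifiedCubeCrossoverCertificateDefs.lean`).  So at FIXED cell
geometry the finite-size condition of the crux (`Θ ≤ ε < 1/M(n) ≤ 1/1776`) FAILS for all sufficiently weak
couplings: the certificate can only hold along a scheme if `β_k` is bounded in terms of `a_k` — a confining-regime
input that `IsYangMillsFor ∧ IsNontrivial ∧ IsNonGaussian` would have to supply.

Proof: take the uniform frame `w i j = b j`, `Y` = the whole cube, `η ≡ 1` and `η′` = the centre-twisted abelian
boundary condition (`FrozenTwist`: flux `π` through every `(0,1)`-slice, carried by the diagonal subgroup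
`D t = diag(e^{it}, e^{-it})` just outside the cube), and `f` = the indicator that the central plaquette
`(0; 0,1)` has rotation angle `< α/2`, `α = π/(S² - 1)`.  By the integral formula for the Wilson kernels
(`integral_ymSpecification`) both expectations are Gibbs ratios over the product Haar measure on the cube's links.
Under `η ≡ 1` the action vanishes at `ζ ≡ 1` and is `≥ 2 - 2cos(α/2)` where `f = 0`; under `η′` the action is
`≤ K M′(2 - 2cos α)` at the twist field and `≥ K M′(2 - 2cos α) + α²/16` where `f = 1` (`FrozenAction`).  The
freezing bound (`FrozenLaplace`) makes the first expectation `≥ 3/4` and the second `≤ 1/4` for `β` past an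
explicit threshold, so their difference — an element of `influenceSet` — is `≥ 1/2`.
No definition is introduced; the objects are built inside the proof.
-/

noncomputable section

namespace Summit.QuantumFields.YangMills.Theorems.CrossoverCertificate.Negative

open Finset Real MeasureTheory
open Literature.MathematicalPhysics.QuantumLattice Literature.Probability.LatticeModels
open Literature.MathematicalPhysics.QuantumFieldTheory
open Summit.QuantumFields.YangMills.Theorems.CovarianceBound.Negative
open Summit.QuantumFields.YangMills.Cruxes.CrossoverCertificate.Birth

/-! ### Small facts about the action and the central plaquette -/

/-- The boundary Wilson action of `SU(2)` (fundamental representation) is non-negative. [folklore] -/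
theorem wilsonBoundaryAction_nonneg (A : Finset (ZdEdge 4)) (U : LGConfig 4 (Matrix.specialUnitaryGroup (Fin 2) ℂ)) :
    0 ≤ wilsonBoundaryAction (fundamentalRep (Fin 2)) A U := by
  rw [wilsonBoundaryAction_fundamentalRep]
  exact Finset.sum_nonneg fun p _ => two_sub_trace_re_nonneg _

/-- A single plaquette touching `A` bounds the action from below: `2 - Re tr U_p ≤ S_A(U)`. [folklore] -/
theorem term_le_wilsonBoundaryAction {A : Finset (ZdEdge 4)} {p : ZdPlaquette 4} (hp : p ∈ plaquettesTouching A)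
    (U : LGConfig 4 (Matrix.specialUnitaryGroup (Fin 2) ℂ)) :
    2 - (((plaquetteHolonomyZd U p.1 p.2.1.1 p.2.1.2 : Matrix.specialUnitaryGroup (Fin 2) ℂ) :
        Matrix (Fin 2) (Fin 2) ℂ).trace).re ≤ wilsonBoundaryAction (fundamentalRep (Fin 2)) A U := by
  rw [wilsonBoundaryAction_fundamentalRep]
  exact Finset.single_le_sum (f := fun p : ZdPlaquette 4 =>
    2 - (((plaquetteHolonomyZd U p.1 p.2.1.1 p.2.1.2 : Matrix.specialUnitaryGroup (Fin 2) ℂ) :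
      Matrix (Fin 2) (Fin 2) ℂ).trace).re) (fun p _ => two_sub_trace_re_nonneg _) hp

/-- The constant configuration `1` has zero boundary action. [folklore] -/
theorem wilsonBoundaryAction_one (A : Finset (ZdEdge 4)) :
    wilsonBoundaryAction (fundamentalRep (Fin 2)) A (fun _ => (1 : Matrix.specialUnitaryGroup (Fin 2) ℂ)) = 0 := by
  rw [wilsonBoundaryAction_fundamentalRep]
  refine Finset.sum_eq_zero fun p _ => ?_
  simp [plaquetteHolonomyZd]

/-- The angle of the central `(0,1)`-plaquette in terms of the plaquette observable of the fundamental
representation. [folklore] -/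
theorem ang_centralPlaquette_eq (U : LGConfig 4 (Matrix.specialUnitaryGroup (Fin 2) ℂ)) :
    ang (plaquetteHolonomyZd U 0 0 1) = Real.arccos (plaquetteObs (fundamentalRep (Fin 2)) 0 0 1 U / 2) := by
  rw [ang_eq_arccos_half_trace_re, plaquetteObs_fundamentalRep]

/-- The slice site `x_{(0,0)} + (2nb+1) e₀ + (2nb+1) e₁` of the central slice is the origin. [folklore] -/
theorem centralSite_eq_zero {L : ℤ} {b n : ℕ} (hL : L = -(2 * (n : ℤ) * b) - 1) :
    ((Pi.single 0 L + Pi.single 1 L + Pi.single 2 ((0 : ℤ), (0 : ℤ)).1 + Pi.single 3 ((0 : ℤ), (0 : ℤ)).2 : Site 4) +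
        Pi.single (0 : Fin 4) ((((2 * n * b + 1 : ℕ), (2 * n * b + 1 : ℕ)) : ℕ × ℕ).1 : ℤ) +
        Pi.single (1 : Fin 4) ((((2 * n * b + 1 : ℕ), (2 * n * b + 1 : ℕ)) : ℕ × ℕ).2 : ℤ)) = 0 := by
  subst hL
  ext k
  fin_cases k <;> simp

/-! ### The main theorem -/

-- The proof builds a dozen objects and long `Finset` expressions in one declaration; the default heartbeat budget
-- does not suffice (checked), hence the raised limit (same idiom as the other `Negative/` files of this problem).
set_option maxHeartbeats 1600000 in
/-- **Frozen coupling: the one-cube influence is at least `1/2`.** For `G = SU(2)` in the fundamental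
representation, every cell size `b ≥ 2` and shell parameter `n ≥ 1` there is `β₀` such that
`1/2 ≤ Θ(ρ_fund, β, b, n)` for all `β ≥ β₀`.  (Registered sub-goal of the lead's analysis of crux
stmt-QuantumFields-16125; it makes the crux's finite-size condition fail at every fixed geometry for all
sufficiently weak couplings.) [folklore] -/
theorem exists_beta0_half_le_influence : ∀ (b n : ℕ), 2 ≤ b → 1 ≤ n → ∃ β₀ : ℝ, ∀ β : ℝ, β₀ ≤ β → (1 / 2 : ℝ) ≤ Summit.QuantumFields.YangMills.Cruxes.CrossoverCertificate.Birth.influence (G := Matrix.specialUnitaryGroup (Fin 2) ℂ) (Literature.MathematicalPhysics.QuantumLattice.fundamentalRep (Fin 2)) β b n := by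
  intro b n hb2 hn
  have hb : 0 < b := by omega
  -- geometry data
  set L : ℤ := -(2 * (n : ℤ) * b) - 1 with hL
  set S : ℕ := (4 * n + 1) * b + 1 with hS
  set A : Finset (ZdEdge 4) := (Finset.biUnion (Fintype.piFinset fun _ : Fin 4 => Finset.Icc (-(2 * ((n : ℕ) : ℤ))) (2 * ((n : ℕ) : ℤ))) (fun y : Fin 4 → ℤ => (Fintype.piFinset fun i : Fin 4 => Finset.Ico (((b : ℕ) : ℤ) * y i) (((b : ℕ) : ℤ) * (y i + 1))) ×ˢ (Finset.univ : Finset (Fin 4)))) with hA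
  set E : Finset (ℕ × ℕ) := ((Finset.range S) ×ˢ (Finset.range S)).erase ((0 : ℕ), (0 : ℕ)) with hE
  set K : ℝ := ((Finset.Icc (L + 1) (L + S - 1) ×ˢ Finset.Icc (L + 1) (L + S - 1)).card : ℝ) with hK
  have hS1 : 1 ≤ S := by rw [hS]; exact Nat.succ_le_succ (Nat.zero_le _)
  have hS11 : 11 ≤ S := by
    rw [hS]; have : 10 ≤ (4 * n + 1) * b := by nlinarith
    omega
  have hEcard : E.card = S * S - 1 := card_slicePlaquettes hS1
  have hcard : 120 ≤ E.card := by
    rw [hEcard]; have : 121 ≤ S * S := by nlinarith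
    omega
  have hcardR : (E.card : ℝ) = (S : ℝ) * S - 1 := by
    rw [hEcard, Nat.cast_sub (by nlinarith), Nat.cast_mul, Nat.cast_one]
  have hcard_pos : (0 : ℝ) < E.card := by exact_mod_cast (show 0 < E.card by omega)
  -- elementary arithmetic about the slice indices (done before any analysis enters the context)
  have hb1 : (1 : ℤ) ≤ b := by exact_mod_cast hb
  have hnb : (0 : ℤ) ≤ (n : ℤ) * b := by positivity
  have hSz : ((S : ℕ) : ℤ) = (4 * (n : ℤ) + 1) * b + 1 := by rw [hS]; push_cast; ring
  have hσ₀ : (((0 : ℤ), (0 : ℤ)) : ℤ × ℤ) ∈ Finset.Icc (L + 1) (L + S - 1) ×ˢ Finset.Icc (L + 1) (L + S - 1) := by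
    rw [Finset.mem_product, Finset.mem_Icc]
    have h1 : L + 1 ≤ 0 := by rw [hL]; linarith only [hnb]
    have h2 : (0 : ℤ) ≤ L + S - 1 := by rw [hL, hSz]; nlinarith only [hnb, hb1]
    exact ⟨⟨h1, h2⟩, h1, h2⟩
  have huv₀ : (((2 * n * b + 1 : ℕ), (2 * n * b + 1 : ℕ)) : ℕ × ℕ) ∈ E := by
    have hlt : 2 * n * b + 1 < S := by
      rw [hS]
      have h4 : 2 * n * b ≤ 4 * n * b := by nlinarith only [Nat.zero_le (n * b)]
      have : (4 * n + 1) * b = 4 * n * b + b := by ring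
      omega
    rw [hE, Finset.mem_erase, Finset.mem_product, Finset.mem_range]
    exact ⟨by simp, hlt, hlt⟩
  -- the angle α = π / M′ and the diagonal subgroup
  set α : ℝ := π / (E.card : ℝ) with hα
  have hα0 : 0 < α := div_pos Real.pi_pos hcard_pos
  have hαπ : α ≤ π := by
    rw [hα, div_le_iff₀ hcard_pos]
    have : (1 : ℝ) ≤ E.card := by exact_mod_cast (show 1 ≤ E.card by omega)
    nlinarith [Real.pi_pos]
  obtain ⟨D, hD, hD0, hDtr, hDang⟩ := exists_su2_diagonal_subgroup
  have hDπ : ang (D (α * ((S : ℝ) * S - 1))) = π := by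
    rw [← hcardR, hα, div_mul_cancel₀ _ hcard_pos.ne']
    exact hDang π Real.pi_pos.le le_rfl
  -- the twist field and the two boundary conditions
  set Uab : LGConfig 4 (Matrix.specialUnitaryGroup (Fin 2) ℂ) := fun e =>
    if e.2 = 1 then D (α * (((e.1 0 - L : ℤ) : ℝ) - if e.1 1 = L ∧ L + 1 ≤ e.1 0 then 1 else 0)) else 1 with hUabdef
  have hUab : ∀ (y : Site 4) (μ : Fin 4), Uab (y, μ) =
      if μ = 1 then D (α * (((y 0 - L : ℤ) : ℝ) - if y 1 = L ∧ L + 1 ≤ y 0 then 1 else 0)) else 1 :=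
    fun y μ => rfl
  set η : LGConfig 4 (Matrix.specialUnitaryGroup (Fin 2) ℂ) := fun _ => 1 with hη
  set η' : LGConfig 4 (Matrix.specialUnitaryGroup (Fin 2) ℂ) := fun e => if e ∈ A then 1 else Uab e with hη'
  -- the observable: indicator that the central plaquette has angle < α/2
  set f : LGConfig 4 (Matrix.specialUnitaryGroup (Fin 2) ℂ) → ℝ := fun U =>
    if Real.arccos (plaquetteObs (fundamentalRep (Fin 2)) 0 0 1 U / 2) < α / 2 then 1 else 0 with hf
  have hρ : Continuous (fundamentalRep (Fin 2)) := continuous_fundamentalRep (Fin 2)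
  have hobs_meas : Measurable fun U : LGConfig 4 (Matrix.specialUnitaryGroup (Fin 2) ℂ) =>
      Real.arccos (plaquetteObs (fundamentalRep (Fin 2)) 0 0 1 U / 2) :=
    (Real.continuous_arccos.comp ((continuous_plaquetteObs (fundamentalRep (Fin 2)) hρ 0 0 1).div_const 2)).measurable
  have hf_meas : Measurable f :=
    Measurable.ite (measurableSet_lt hobs_meas measurable_const) measurable_const measurable_const
  have hf01 : ∀ U, 0 ≤ f U ∧ f U ≤ 1 := by
    intro U; simp only [hf]; split_ifs <;> norm_num
  have hf_ang : ∀ U, f U = if ang (plaquetteHolonomyZd U 0 0 1) < α / 2 then 1 else 0 := by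
    intro U; rw [ang_centralPlaquette_eq]
  -- the central plaquette touches the cube, and its edges lie in the central cell
  have hp0 : (((0 : Site 4), ⟨((0 : Fin 4), (1 : Fin 4)), by decide⟩) : ZdPlaquette 4) ∈ plaquettesTouching A := by
    rw [mem_plaquettesTouching_iff]
    refine ⟨((0 : Site 4), (0 : Fin 4)), Finset.mem_inter.2 ⟨by simp [plaquetteEdges], ?_⟩⟩
    rw [hA, mem_cubeEdges_iff hb]
    intro i
    have : (1 : ℤ) ≤ b := by exact_mod_cast hb
    constructor <;> simp <;> nlinarith
  -- f is a cylinder function of the central cell's edges (the central plaquette's links lie in the cell, b ≥ 2)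
  have hcyl : IsCylinder f ((Fintype.piFinset fun i : Fin 4 =>
      Finset.Ico (((b : ℕ) : ℤ) * (0 : Fin 4 → ℤ) i) (((b : ℕ) : ℤ) * ((0 : Fin 4 → ℤ) i + 1))) ×ˢ
        (Finset.univ : Finset (Fin 4))) := by
    intro U V hUV
    have hobs : plaquetteObs (fundamentalRep (Fin 2)) 0 0 1 U = plaquetteObs (fundamentalRep (Fin 2)) 0 0 1 V := by
      refine isCylinder_plaquetteObs (fundamentalRep (Fin 2))
        (((0 : Site 4), ⟨((0 : Fin 4), (1 : Fin 4)), by decide⟩) : ZdPlaquette 4) (fun e he => hUV e ?_)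
      have hb1 : (1 : ℤ) < b := by exact_mod_cast hb2
      simp only [Finset.mem_coe, plaquetteEdges, Finset.mem_insert, Finset.mem_singleton] at he
      rw [Finset.mem_coe, Finset.mem_product, Fintype.mem_piFinset]
      rcases he with rfl | rfl | rfl | rfl <;> refine ⟨fun i => ?_, Finset.mem_univ _⟩ <;> fin_cases i <;>
        simp <;> omega
    simp only [hf, hobs]
  -- the two boundary conditions agree on the cube
  have hagree : ∀ e ∈ A, η e = η' e := by
    intro e he
    simp only [hη, hη', if_pos he]
  -- the kernels as Gibbs ratios over the product Haar measure on the cube's links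
  set ν : Measure (↥A → Matrix.specialUnitaryGroup (Fin 2) ℂ) :=
    Measure.pi fun _ : ↥A => haarProbability (Matrix.specialUnitaryGroup (Fin 2) ℂ) with hν
  haveI : Measure.IsOpenPosMeasure (haarProbability (Matrix.specialUnitaryGroup (Fin 2) ℂ)) := by
    unfold haarProbability; infer_instance
  haveI : Measure.IsOpenPosMeasure ν := by rw [hν]; infer_instance
  set ψ₁ : (↥A → Matrix.specialUnitaryGroup (Fin 2) ℂ) → ℝ :=
    fun ζ => wilsonBoundaryAction (fundamentalRep (Fin 2)) A (glueWith A ζ η) with hψ₁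
  set ψ₂ : (↥A → Matrix.specialUnitaryGroup (Fin 2) ℂ) → ℝ :=
    fun ζ => wilsonBoundaryAction (fundamentalRep (Fin 2)) A (glueWith A ζ η') with hψ₂
  have hψ₁c : Continuous ψ₁ := (continuous_wilsonBoundaryAction (fundamentalRep (Fin 2)) hρ A).comp
    ((continuous_glueWith_prod A).comp (Continuous.prodMk_right η))
  have hψ₂c : Continuous ψ₂ := (continuous_wilsonBoundaryAction (fundamentalRep (Fin 2)) hρ A).comp
    ((continuous_glueWith_prod A).comp (Continuous.prodMk_right η'))
  have hψ₁0 : ∀ ζ, 0 ≤ ψ₁ ζ := fun ζ => wilsonBoundaryAction_nonneg A _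
  have hψ₂0 : ∀ ζ, 0 ≤ ψ₂ ζ := fun ζ => wilsonBoundaryAction_nonneg A _
  -- (1) trivial boundary condition: the action vanishes at ζ ≡ 1 and is ≥ δ₁ where f = 0
  set δ₁ : ℝ := 2 - 2 * Real.cos (α / 2) with hδ₁
  have hδ₁ : 0 < δ₁ := by
    have hc : Real.cos (α / 2) ≠ 1 := by
      rw [Ne, Real.cos_eq_one_iff_of_lt_of_lt (by linarith [Real.pi_pos]) (by linarith)]
      exact (half_pos hα0).ne'
    have hc' : Real.cos (α / 2) ≤ 1 := Real.cos_le_one _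
    rw [hδ₁]
    have : Real.cos (α / 2) < 1 := lt_of_le_of_ne hc' hc
    linarith
  have hvanish₁ : ∀ ζ, ψ₁ ζ < 0 + δ₁ → (1 - f (glueWith A ζ η)) = 0 := by
    intro ζ hζ
    rw [hf_ang]
    by_cases hlt : ang (plaquetteHolonomyZd (glueWith A ζ η) 0 0 1) < α / 2
    · rw [if_pos hlt]; ring
    · exfalso
      have hge : α / 2 ≤ ang (plaquetteHolonomyZd (glueWith A ζ η) 0 0 1) := not_lt.1 hlt
      have hcos : Real.cos (ang (plaquetteHolonomyZd (glueWith A ζ η) 0 0 1)) ≤ Real.cos (α / 2) :=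
        Real.cos_le_cos_of_nonneg_of_le_pi (by linarith) (ang_le_pi _) hge
      have h1 := term_le_wilsonBoundaryAction hp0 (glueWith A ζ η)
      rw [two_sub_trace_re_eq] at h1
      have : δ₁ ≤ ψ₁ ζ := by
        show 2 - 2 * Real.cos (α / 2) ≤ wilsonBoundaryAction (fundamentalRep (Fin 2)) A (glueWith A ζ η)
        exact le_trans (by linarith only [hcos]) h1
      linarith only [this, hζ]
  have hglue₁ : glueWith A (fun _ : ↥A => (1 : Matrix.specialUnitaryGroup (Fin 2) ℂ)) η =
      fun _ => (1 : Matrix.specialUnitaryGroup (Fin 2) ℂ) := by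
    funext e
    by_cases he : e ∈ A
    · rw [glueWith_apply_mem _ _ _ he]
    · rw [glueWith_apply_not_mem _ _ _ he]
  have hpos₁ : 0 < ν.real {ζ | ψ₁ ζ < 0 + δ₁ / 2} := by
    have hopen : IsOpen {ζ : ↥A → Matrix.specialUnitaryGroup (Fin 2) ℂ | ψ₁ ζ < 0 + δ₁ / 2} :=
      isOpen_lt hψ₁c continuous_const
    have hne : (fun _ : ↥A => (1 : Matrix.specialUnitaryGroup (Fin 2) ℂ)) ∈
        {ζ : ↥A → Matrix.specialUnitaryGroup (Fin 2) ℂ | ψ₁ ζ < 0 + δ₁ / 2} := by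
      show wilsonBoundaryAction (fundamentalRep (Fin 2)) A (glueWith A (fun _ => 1) η) < 0 + δ₁ / 2
      rw [hglue₁, wilsonBoundaryAction_one]; linarith only [hδ₁]
    exact ENNReal.toReal_pos (hopen.measure_pos ν ⟨_, hne⟩).ne' (measure_ne_top ν _)
  -- (2) twisted boundary condition: the action is ≤ m at the twist field and ≥ m + δ₂ where f = 1
  set m : ℝ := K * ((E.card : ℝ) * (2 - 2 * Real.cos (π / (E.card : ℝ)))) with hm
  set δ₂ : ℝ := (π / (E.card : ℝ)) ^ 2 / 16 with hδ₂
  have hδ₂ : 0 < δ₂ := by rw [hδ₂]; positivity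
  have hvanish₂ : ∀ ζ, ψ₂ ζ < m + δ₂ → f (glueWith A ζ η') = 0 := by
    intro ζ hζ
    rw [hf_ang]
    by_cases hlt : ang (plaquetteHolonomyZd (glueWith A ζ η') 0 0 1) < α / 2
    · exfalso
      have hUglue : ∀ e, e ∉ A → glueWith A ζ η' e = Uab e := by
        intro e he
        rw [glueWith_apply_not_mem _ _ _ he, hη']
        exact if_neg he
      have hbound : m + δ₂ ≤ ψ₂ ζ := by
        refine action_ge_of_small_angle hb hA hL hS hD hD0 hDπ hUab hUglue hcard hσ₀ huv₀ ?_
        rw [centralSite_eq_zero hL]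
        exact hlt.le
      linarith only [hbound, hζ]
    · rw [if_neg hlt]
  have hglue₂ : glueWith A (fun e : ↥A => Uab e) η' = Uab := by
    funext e
    by_cases he : e ∈ A
    · rw [glueWith_apply_mem _ _ _ he]
    · rw [glueWith_apply_not_mem _ _ _ he, hη']
      exact if_neg he
  have hpos₂ : 0 < ν.real {ζ | ψ₂ ζ < m + δ₂ / 2} := by
    have hopen : IsOpen {ζ : ↥A → Matrix.specialUnitaryGroup (Fin 2) ℂ | ψ₂ ζ < m + δ₂ / 2} :=
      isOpen_lt hψ₂c continuous_const
    have hne : (fun e : ↥A => Uab e) ∈ {ζ : ↥A → Matrix.specialUnitaryGroup (Fin 2) ℂ | ψ₂ ζ < m + δ₂ / 2} := by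
      show wilsonBoundaryAction (fundamentalRep (Fin 2)) A (glueWith A (fun e : ↥A => Uab e) η') < m + δ₂ / 2
      rw [hglue₂]
      have hm' : wilsonBoundaryAction (fundamentalRep (Fin 2)) A Uab ≤ m :=
        action_twist_le hb hA hL hS hD hD0 hα0.le hαπ hDang hUab
      linarith only [hm', hδ₂]
    exact ENNReal.toReal_pos (hopen.measure_pos ν ⟨_, hne⟩).ne' (measure_ne_top ν _)
  -- thresholds
  refine ⟨max (max 0 (2 / δ₁ * Real.log (4 / ν.real {ζ | ψ₁ ζ < 0 + δ₁ / 2})))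
    (max 0 (2 / δ₂ * Real.log (4 / ν.real {ζ | ψ₂ ζ < m + δ₂ / 2}))), fun β hβ => ?_⟩
  have hβ₁ := le_trans (le_max_left _ _) hβ
  have hβ₂ := le_trans (le_max_right _ _) hβ
  have hR₁ : (∫ ζ, (1 - f (glueWith A ζ η)) * Real.exp (-β * ψ₁ ζ) ∂ν) / (∫ ζ, Real.exp (-β * ψ₁ ζ) ∂ν) ≤ 1 / 4 :=
    gibbsRatio_le_quarter ν hψ₁c.measurable (fun ζ => hψ₁0 ζ)
      (fun ζ => ⟨by linarith [(hf01 (glueWith A ζ η)).2], by linarith [(hf01 (glueWith A ζ η)).1]⟩)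
      hδ₁ hvanish₁ hpos₁ hβ₁
  have hR₂ : (∫ ζ, f (glueWith A ζ η') * Real.exp (-β * ψ₂ ζ) ∂ν) / (∫ ζ, Real.exp (-β * ψ₂ ζ) ∂ν) ≤ 1 / 4 :=
    gibbsRatio_le_quarter ν hψ₂c.measurable (fun ζ => hψ₂0 ζ) (fun ζ => hf01 _) hδ₂ hvanish₂ hpos₂ hβ₂
  -- the kernels' integrals
  haveI hprob₁ : IsProbabilityMeasure (ymSpecification (fundamentalRep (Fin 2)) β A η) :=
    isProbabilityMeasure_ymSpecification _ hρ β A η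
  have hI₁' : ∫ U, (1 - f U) ∂(ymSpecification (fundamentalRep (Fin 2)) β A η) =
      (∫ ζ, (1 - f (glueWith A ζ η)) * Real.exp (-β * ψ₁ ζ) ∂ν) / (∫ ζ, Real.exp (-β * ψ₁ ζ) ∂ν) :=
    integral_ymSpecification (fundamentalRep (Fin 2)) hρ β A (measurable_const.sub hf_meas) η
  have hI₁ : ∫ U, f U ∂(ymSpecification (fundamentalRep (Fin 2)) β A η) =
      1 - ∫ U, (1 - f U) ∂(ymSpecification (fundamentalRep (Fin 2)) β A η) := by
    have hfi : Integrable f (ymSpecification (fundamentalRep (Fin 2)) β A η) :=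
      integrable_of_bound hf_meas.aestronglyMeasurable (C := 1) (fun U => by
        rw [abs_le]; exact ⟨by linarith [(hf01 U).1], (hf01 U).2⟩)
    rw [integral_sub (integrable_const _) hfi, integral_const, smul_eq_mul, mul_one, probReal_univ]
    ring
  have hI₂ : ∫ U, f U ∂(ymSpecification (fundamentalRep (Fin 2)) β A η') =
      (∫ ζ, f (glueWith A ζ η') * Real.exp (-β * ψ₂ ζ) ∂ν) / (∫ ζ, Real.exp (-β * ψ₂ ζ) ∂ν) :=
    integral_ymSpecification (fundamentalRep (Fin 2)) hρ β A hf_meas η'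
  have final : (1 / 2 : ℝ) ≤ |(∫ U, f U ∂(ymSpecification (fundamentalRep (Fin 2)) β A η)) -
      ∫ U, f U ∂(ymSpecification (fundamentalRep (Fin 2)) β A η')| := by
    refine le_trans ?_ (le_abs_self _)
    rw [hI₁, hI₁', hI₂]
    linarith only [hR₁, hR₂]
  -- membership in the influence set (frame w i j = b j, Y = the whole cube)
  have hw : ∀ (i : Fin 4) (j : ℤ), (fun (_ : Fin 4) (j : ℤ) => ((b : ℕ) : ℤ) * j) i j + ((b : ℕ) : ℤ) ≤
      (fun (_ : Fin 4) (j : ℤ) => ((b : ℕ) : ℤ) * j) i (j + 1) ∧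
      (fun (_ : Fin 4) (j : ℤ) => ((b : ℕ) : ℤ) * j) i (j + 1) ≤
        (fun (_ : Fin 4) (j : ℤ) => ((b : ℕ) : ℤ) * j) i j + 2 * ((b : ℕ) : ℤ) := by
    intro i j
    have : (0 : ℤ) ≤ b := by positivity
    constructor <;> simp only [] <;> nlinarith
  have h0 : (0 : Fin 4 → ℤ) ∈ (Fintype.piFinset fun _ : Fin 4 => Finset.Icc (-(2 * ((n : ℕ) : ℤ))) (2 * ((n : ℕ) : ℤ))) :=
    Fintype.mem_piFinset.2 fun i => Finset.mem_Icc.2 ⟨by simp, by simp⟩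
  exact le_trans final (le_influence (fundamentalRep (Fin 2)) β b n
    ⟨fun (_ : Fin 4) (j : ℤ) => ((b : ℕ) : ℤ) * j, fun i j => hw i j, _, Finset.Subset.refl _, h0, η, η', hagree,
      f, hcyl, hf_meas, hf01, rfl⟩)

end Summit.QuantumFields.YangMills.Theorems.CrossoverCertificate.Negative

end
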